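import Summits.QuantumFields.YangMills.Theorems.UnitScaleTiltProp7TentQuasiInterpolant
import Summits.QuantumFields.YangMills.Theorems.UnitScaleTiltProp7FibrewiseSectionRows
import Summits.QuantumFields.YangMills.Theorems.UnitScaleTiltProp7TentProfileBox
import HarnessLib

/-!
# Route `UnitScaleTilt`, crux K1 «MinimiserStabilityRegPr» (stmt-QuantumFields-19200) — route-R E′ (A′), LANE II «DIVERGENCE RECOVERY AT CURVED `W`» (★★OWNER RULING №23),
# brick (B2a) = SIGNATURE-0 (B2a) of ★p1 g19 (a47f22982299de03), FILE F5 «THE GLUE»: **A SMOOTH EXACT RIGHT INVERSE OF `QprimeCombL2 W` ON `RegPr`** —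
# `J := I_σ + J⁰_σ ∘ N ∘ (1 − Q′_W ∘ I_σ)` with exactness, the GRADIENT row in the coarse one-bond currency, and the SIZE row

Cell `ym3-torus` ∕ width seat `ym3-torus-px3` (gen 6) on ★p1 g19's OFFER 08:10:46Z (recipe (i)–(v)).  THEOREMS ONLY (0 `def`, 0 `sorry`); `--supports stmt-QuantumFields-19200 --as helper`,
count-neutral.  YM₃ on T³ is a ladder rung (R3), not d = 4, not infinite volume, not the Clay problem; nothing here claims [Balaban1985BackgroundPropagators] Thm 3.11, `hN06`, (REC), E′, EX or the gap.

ASSEMBLY (every input BY NAME): (i) the tent quasi-interpolant `I_σ` and its rows ✓`Prop7TentQuasiInterpolant.exists_tentQuasiInterpolant` (px3 F4: `CI CI′ CR CR′ CS eI`); (ii) the bump section `J⁰_σ`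
✓`Prop7QprimeCombBumpSection.exists_bumpSection` (★p1 F2) at the one-shot axial frame (px15 ✓`Prop7OneShotAxialFrameRows`: periodic, `U1`, thin `ϑ = 4e`) and the tensor-tent profile (px9
✓`Prop7TentProfileBox`: periodic, `0 ≤ β ≤ 92`, in-box increments `183η`, boundary zeros, `Σ_{box}((L³)⁻¹)ᵏβ = 1`), its rows ✓`Prop7QprimeCombBumpSectionRows.norm_sq_DL2_section_le`∕`norm_sq_toL2S_section_le` (★p1 F2b);
(iii) the fibre maps `M_y m = Σ_{x ∈ box y}((L³)⁻¹)ᵏβ(x)·Ad(τ_W(y,x)σ(x)⁻¹) m` with `‖M_y m − m‖ ≤ θ‖m‖`, `θ = 2·14616·e ≤ ½` (px15 ✓`Prop7TentFrameRowsOfRegPr.tentFrame_rep_of_regPr` over px5 ✓F3);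
(iv) exactness by the fibrewise correction ✓`Prop7QprimeCombBumpSection.exists_exact_of_fibrewise_near_id` (★p1 F2 §4); (v) the rows of `J` by px9's ✓`Prop7FibrewiseSectionRows.gradRow_correction_of_fibre_bound'` ∕
`sizeRow_correction_of_fibre_bound'` with `κ² ≤ 4`, `G w ≤ 12‖w‖♮²` for the size row.  Constants: `CJ = 2CI + 8b·CR`, `CJ′ = 2CI′ + 8b·CR′`, `CJ″ = 2CS + 8b′(12CR + CR′)`, `b = 6·919²`, `b′ = 2·92²`,
`e2 = min eI (min e₃ (1∕58464))` (`≤ 1`).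

References: T. Bałaban, CMP **99** (1985) 389–434 [Balaban1985BackgroundPropagators] ((3.17)–(3.19) p.393, (3.21) p.394, Thm 3.11 p.416); CMP **98** (1985) 17–51 [Balaban1985Averaging] ((52)–(53) p.27,
(78)–(80) p.30); CMP **99** (1985) 75–102 [Balaban1985RegularSpaces] ((1.7) p.77, (1.70) p.88).
-/

set_option autoImplicit false

noncomputable section

open scoped InnerProductSpace ComplexConjugate Matrix.Norms.L2Operator BigOperators

namespace Summit.QuantumFields.YangMills.Theorems.Prop7QprimeCombRightInverse

open Literature.MathematicalPhysics.QuantumFieldTheory.Balaban1983to89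
open Literature.MathematicalPhysics.QuantumFieldTheory.Balaban1983to89.T3ContinuumYM3Torus
open Literature.MathematicalPhysics.QuantumFieldTheory.Balaban1983to89.T3PrintedRegularMinimiser (RegPr)
open Literature.MathematicalPhysics.QuantumLattice (blockMap blockBase)
open B7Prop1Explicit renaming Site → LSite
open B7Prop1Explicit (U1 mem_U1 axialFn e)
open B7Eq78Linearization (conjR conjR_apply conjR_smul_real)
open B8Eq119TwistedAxial (bgT)
open B8Eq143PlaqExpansion (norm_conjR_sub_self_le)
open B9B8AveragingKernelZd (blockIter compT)
open B10Eq27TorusAxialLog (transl holT unitsField toUField pull)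
open B10StarCount (sum_pbond)
open T4TermwiseTorus (tlift tcls)
open T3SectALandauChart (bgUnits eta pos_of_regPr)
open B11Eq103H1Complex (SiteL2K BondL2K)
open Summit.QuantumFields.YangMills.Theorems.Prop7SectET3Transport (periodsT3)
open Summit.QuantumFields.YangMills.Theorems.Prop7SectET3HilbertLetters (W₂ toL2S DL2)
open Summit.QuantumFields.YangMills.Theorems.Prop7SPrint (basePt)
open Summit.QuantumFields.YangMills.Theorems.Prop7QprimeCombL2 (QprimeCombL2)
open Summit.QuantumFields.YangMills.Theorems.Prop7QprimeCombBumpSection (exists_bumpSection exists_exact_of_fibrewise_near_id)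
open Summit.QuantumFields.YangMills.Theorems.Prop7QprimeCombBumpSectionRows (norm_sq_DL2_section_le norm_sq_toL2S_section_le)
open Summit.QuantumFields.YangMills.Theorems.Prop7OneShotAxialFrameRows (oneShotAxial_isPeriodic oneShotAxial_mem_U1 norm_oneShotAxial_bond_sub_one_le_of_regPr)
open Summit.QuantumFields.YangMills.Theorems.Prop7TentProfileBox (isPeriodic_profile profile_nonneg_member abs_profile_le_member abs_profile_succ_sub_le_member profile_eq_zero_member sum_blockIter_profile_member)
open Summit.QuantumFields.YangMills.Theorems.Prop7TentFrameRowsOfRegPr (tentFrame_rep_of_regPr)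
open Summit.QuantumFields.YangMills.Theorems.Prop7TentQuasiInterpolant (exists_tentQuasiInterpolant)
open Summit.QuantumFields.YangMills.Theorems.Prop7FibrewiseSectionRows (fibre_bound_of_fibrewise gradRow_correction_of_fibre_bound' sizeRow_correction_of_fibre_bound' inv_one_sub_sq_le_four)
open Summit.QuantumFields.YangMills.Theorems.Prop7CoarseStaircaseTelescoping (sum_comp_transl_eq transl_one_zsmul_e)

variable (c₀ : ℕ → ℝ) [hc₀ : ∀ L : ℕ, Fact (0 < c₀ L)]

/-- **THE COARSE ONE-BOND CURRENCY IS BOUNDED BY THE MASS**: `Σ_c ‖Ad(T c) w(c.src.shift c.dir) − w c.src‖² ≤ 12·Σ_y ‖w y‖²` (`d = 3`: every site is the source of three and the target of three bonds;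
`‖a − b‖² ≤ 2‖a‖² + 2‖b‖²`; `Ad` is isometric on `U1`). [folklore; cite: Balaban1985Averaging, (8)-(9) p.18] -/
theorem sum_norm_sq_bondDiff_le (F : T3Family) (n K : ℕ) (T : PBond (F.P K) (K - n) → (Matrix (Fin 2) (Fin 2) ℂ)ˣ) (hT : ∀ c, T c ∈ U1 (Matrix (Fin 2) (Fin 2) ℂ))
    (w : Site (F.P K) (K - n) → Matrix (Fin 2) (Fin 2) ℂ) :
    ∑ c : PBond (F.P K) (K - n), ‖conjR (T c) (w (c.src.shift c.dir)) - w c.src‖ ^ 2 ≤ 12 * ∑ y : Site (F.P K) (K - n), ‖w y‖ ^ 2 := by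
  have hb : ∀ c : PBond (F.P K) (K - n), ‖conjR (T c) (w (c.src.shift c.dir)) - w c.src‖ ^ 2 ≤ 2 * ‖w (c.src.shift c.dir)‖ ^ 2 + 2 * ‖w c.src‖ ^ 2 := by
    intro c
    have h1 : ‖conjR (T c) (w (c.src.shift c.dir)) - w c.src‖ ≤ ‖w (c.src.shift c.dir)‖ + ‖w c.src‖ := by
      calc _ ≤ ‖conjR (T c) (w (c.src.shift c.dir))‖ + ‖w c.src‖ := norm_sub_le _ _
        _ = ‖w (c.src.shift c.dir)‖ + ‖w c.src‖ := by rw [B8Ineq132.norm_conjR (hT c)]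
    nlinarith [norm_nonneg (conjR (T c) (w (c.src.shift c.dir)) - w c.src), norm_nonneg (w (c.src.shift c.dir)), norm_nonneg (w c.src),
      sq_nonneg (‖w (c.src.shift c.dir)‖ - ‖w c.src‖)]
  have hsrc : ∑ c : PBond (F.P K) (K - n), ‖w c.src‖ ^ 2 = (F.P K).d * ∑ y : Site (F.P K) (K - n), ‖w y‖ ^ 2 := by
    rw [sum_pbond]; simp only []
    rw [Finset.sum_comm, Finset.sum_const, Finset.card_univ, Fintype.card_fin, nsmul_eq_mul]
  have htgt : ∑ c : PBond (F.P K) (K - n), ‖w (c.src.shift c.dir)‖ ^ 2 = (F.P K).d * ∑ y : Site (F.P K) (K - n), ‖w y‖ ^ 2 := by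
    rw [sum_pbond]; simp only []
    rw [Finset.sum_comm]
    have hμ : ∀ μ : Fin (F.P K).d, ∑ x : Site (F.P K) (K - n), ‖w (x.shift μ)‖ ^ 2 = ∑ y : Site (F.P K) (K - n), ‖w y‖ ^ 2 := by
      intro μ
      rw [← sum_comp_transl_eq ((1 : ℤ) • e μ) (fun y => ‖w y‖ ^ 2)]
      exact Finset.sum_congr rfl fun y _ => by rw [transl_one_zsmul_e]
    rw [Finset.sum_congr rfl fun μ _ => hμ μ, Finset.sum_const, Finset.card_univ, Fintype.card_fin, nsmul_eq_mul]
  have hd : (((F.P K).d : ℕ) : ℝ) = 3 := by exact_mod_cast T3Family.P_d F K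
  calc ∑ c : PBond (F.P K) (K - n), ‖conjR (T c) (w (c.src.shift c.dir)) - w c.src‖ ^ 2
      ≤ ∑ c : PBond (F.P K) (K - n), (2 * ‖w (c.src.shift c.dir)‖ ^ 2 + 2 * ‖w c.src‖ ^ 2) := Finset.sum_le_sum fun c _ => hb c
    _ = 2 * ((F.P K).d * ∑ y : Site (F.P K) (K - n), ‖w y‖ ^ 2) + 2 * ((F.P K).d * ∑ y : Site (F.P K) (K - n), ‖w y‖ ^ 2) := by
        rw [Finset.sum_add_distrib, ← Finset.mul_sum, ← Finset.mul_sum, htgt, hsrc]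
    _ = 12 * ∑ y : Site (F.P K) (K - n), ‖w y‖ ^ 2 := by rw [hd]; ring

/-- Pure-real bookkeeping of the GRADIENT constants: `κ² ≤ 4`, `b(e) ≤ b`. [folklore] -/
theorem grad_constants_le {CI CI' CR CR' b e G Mw bb kk : ℝ} (hCR : 0 ≤ CR) (hCR' : 0 ≤ CR') (hb : 0 ≤ b) (hG : 0 ≤ G) (hMw : 0 ≤ Mw)
    (hbb1 : bb ≤ b) (hk0 : 0 ≤ kk) (hk1 : kk ≤ 4) :
    (2 * CI + 2 * bb * kk * CR) * G + (2 * (CI' * e ^ 2) + 2 * bb * kk * (CR' * e ^ 2)) * Mw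
      ≤ (2 * CI + 8 * b * CR) * G + (2 * CI' + 8 * b * CR') * e ^ 2 * Mw := by
  have t1 : 2 * bb * kk * CR * G ≤ 2 * b * 4 * CR * G := by gcongr
  have t2 : 2 * bb * kk * (CR' * e ^ 2) * Mw ≤ 2 * b * 4 * (CR' * e ^ 2) * Mw := by
    have : 0 ≤ CR' * e ^ 2 := by positivity
    gcongr
  linarith [t1, t2]

/-- Pure-real bookkeeping of the SIZE constants: `κ² ≤ 4`, `G ≤ 12·M`, `e² ≤ 1`. [folklore] -/
theorem size_constants_le {CS CR CR' b' e G Mw kk : ℝ} (hCR : 0 ≤ CR) (hCR' : 0 ≤ CR') (hb' : 0 ≤ b') (hG : 0 ≤ G) (hMw : 0 ≤ Mw)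
    (hGM : G ≤ 12 * Mw) (hk1 : kk ≤ 4) (he1 : e ^ 2 ≤ 1) :
    (2 * 0 + 2 * b' * kk * CR) * G + (2 * CS + 2 * b' * kk * (CR' * e ^ 2)) * Mw ≤ (2 * CS + 8 * b' * (12 * CR + CR')) * Mw := by
  have t1 : 2 * b' * kk * CR * G ≤ 2 * b' * 4 * CR * (12 * Mw) := by gcongr
  have t2 : 2 * b' * kk * (CR' * e ^ 2) * Mw ≤ 2 * b' * 4 * (CR' * 1) * Mw := by gcongr
  linarith [t1, t2]

set_option maxHeartbeats 400000 in
/-- ★★★ (B2a) **A SMOOTH EXACT RIGHT INVERSE OF `QprimeCombL2 W` ON `RegPr`** — SIGNATURE-0 (B2a) of ★p1 g19 VERBATIM: for every unitary coarse transporter `T` which is `CT·e`-close to the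
straight fine transport between the box corners (the (B3c) row), a ℂ-linear `J` with `Q′_W ∘ J = id`, the GRADIENT row in the `c₀ℓ³Σ` coarse currency against `D̄_T`, and the SIZE row; constants
L-only, bound BEFORE `F n K e W T`.  Construction `J := I_σ + J⁰_σ ∘ N ∘ (1 − Q′_W ∘ I_σ)`.
[cite: Balaban1985BackgroundPropagators, (3.17)-(3.19) p.393, (3.21) p.394; Balaban1985Averaging, (52)-(53) p.27, (78)-(80) p.30; Balaban1985RegularSpaces, (1.7) p.77] -/
theorem exists_smoothRightInverse_QprimeCombL2 :
    ∀ (L : ℕ), 1 < L → ∀ (CT : ℝ), 0 ≤ CT → ∃ CJ CJ' CJ'' e2 : ℝ, 0 ≤ CJ ∧ 0 ≤ CJ' ∧ 0 ≤ CJ'' ∧ 0 < e2 ∧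
      ∀ (F : T3Family), F.L = L → ∀ (n K : ℕ) (hnK : n < K) (e : ℝ), 0 ≤ e → e ≤ e2 →
        ∀ (W : GaugeField (F.P K) 0 (Matrix.specialUnitaryGroup (Fin 2) ℂ)), RegPr F n K e W →
        ∀ (T : PBond (F.P K) (K - n) → (Matrix (Fin 2) (Fin 2) ℂ)ˣ), (∀ c, T c ∈ U1 (Matrix (Fin 2) (Fin 2) ℂ)) →
          (∀ c : PBond (F.P K) (K - n),
            ‖(T c : Matrix (Fin 2) (Fin 2) ℂ) - ((holT (unitsField (toUField W)) (transl (basePt F n K) (blockBase ((F.P K).L ^ (K - n)) (tlift c.src)))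
                (List.replicate ((F.P K).L ^ (K - n)) (c.dir, true)) : (Matrix (Fin 2) (Fin 2) ℂ)ˣ) : Matrix (Fin 2) (Fin 2) ℂ)‖ ≤ CT * e) →
        ∃ J : (Site (F.P K) (K - n) → Matrix (Fin 2) (Fin 2) ℂ) →ₗ[ℂ] SiteL2K ℂ 3 (periodsT3 F K) (c₀ F.L) W₂,
          (∀ w, QprimeCombL2 F n K (c₀ F.L) W (J w) = w) ∧
          (∀ w, ‖DL2 F n K (c₀ F.L) W (J w)‖ ^ 2
              ≤ CJ * (c₀ F.L * ((F.L : ℝ) ^ (K - n)) ^ 3 * ∑ c : PBond (F.P K) (K - n), ‖conjR (T c) (w (c.src.shift c.dir)) - w c.src‖ ^ 2)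
                + CJ' * e ^ 2 * (c₀ F.L * ((F.L : ℝ) ^ (K - n)) ^ 3 * ∑ y : Site (F.P K) (K - n), ‖w y‖ ^ 2)) ∧
          (∀ w, ‖J w‖ ^ 2 ≤ CJ'' * (c₀ F.L * ((F.L : ℝ) ^ (K - n)) ^ 3 * ∑ y : Site (F.P K) (K - n), ‖w y‖ ^ 2)) := by
  intro L hL CT hCT
  obtain ⟨CI, CI', CR, CR', CS, eI, hCI, hCI', hCR, hCR', hCS, heI, hF4⟩ := exists_tentQuasiInterpolant c₀ L hL CT hCT
  obtain ⟨e₃, he₃, hrep⟩ := tentFrame_rep_of_regPr L hL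
  -- constants: `b` = the bump section's gradient constant at `e ≤ 1`, `b'` its size constant
  set b : ℝ := 6 * (183 + 2 * 92 * 4) ^ 2 with hbdef
  set b' : ℝ := 2 * 92 ^ 2 with hb'def
  refine ⟨2 * CI + 8 * b * CR, 2 * CI' + 8 * b * CR', 2 * CS + 8 * b' * (12 * CR + CR'), min eI (min e₃ (1 / 58464)),
    by positivity, by positivity, by positivity, lt_min heI (lt_min he₃ (by norm_num)), ?_⟩
  intro F hF n K hnK e he0 he2 W hW T hT hclose
  have he : 0 < e := pos_of_regPr F hW
  have heI' : e ≤ eI := he2.trans (min_le_left _ _)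
  have he₃' : e ≤ e₃ := he2.trans ((min_le_right _ _).trans (min_le_left _ _))
  have hew : e ≤ 1 / 58464 := he2.trans ((min_le_right _ _).trans (min_le_right _ _))
  have he1 : e ≤ 1 := hew.trans (by norm_num)
  have hc : 0 < c₀ F.L := (hc₀ F.L).out
  haveI : NeZero (F.P K).L := ⟨by have h := F.hL.2; show F.L ≠ 0; omega⟩
  set ℓ : ℕ := (F.P K).L ^ (K - n) with hℓ
  set Nk : ℕ := (F.P K).sitesPerDir (K - n) with hNk
  set V := pull (bgUnits F K W) (basePt F n K) with hVdef
  -- (i) the tent quasi-interpolant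
  obtain ⟨I, -, hIgrad, hIrep, hIsize⟩ := hF4 F hF n K hnK e he0 heI' W hW T hT hclose
  -- (ii) the bump section at the one-shot axial frame and the tensor-tent profile
  set σ : LSite (F.P K).d → (Matrix (Fin 2) (Fin 2) ℂ)ˣ := fun x => axialFn V (blockBase ℓ ((blockMap (F.P K).L)^[K - n] x)) x with hσ
  set β : LSite (F.P K).d → ℝ := fun z => (((((F.P K).L ^ (K - n) : ℕ) : ℝ) ^ (F.P K).d / (∑ s ∈ Finset.range ((F.P K).L ^ (K - n)), ((min (s : ℤ) ((((F.P K).L ^ (K - n) : ℕ) : ℤ) - 1 - (s : ℤ)) : ℤ) : ℝ)) ^ (F.P K).d) * ∏ i : Fin (F.P K).d, ((min ((z i) % (((F.P K).L ^ (K - n) : ℕ) : ℤ)) ((((F.P K).L ^ (K - n) : ℕ) : ℤ) - 1 - (z i) % (((F.P K).L ^ (K - n) : ℕ) : ℤ)) : ℤ) : ℝ)) with hβ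
  obtain ⟨J₀, hJ₀pt, hJ₀avg⟩ := exists_bumpSection F n K (c₀ F.L) hnK.le W σ β (oneShotAxial_isPeriodic F n K hnK.le W) (isPeriodic_profile F n K hnK.le)
  -- (iii) the fibre maps
  set g : LSite (F.P K).d → LSite (F.P K).d → (Matrix (Fin 2) (Fin 2) ℂ)ˣ := fun Y x => compT (F.P K).L (bgT (F.P K).L V) (K - n) Y x * (σ x)⁻¹ with hg
  set ω : LSite (F.P K).d → ℝ := fun x => ((((F.P K).L : ℝ) ^ (F.P K).d)⁻¹) ^ (K - n) * β x with hω
  have hω0 : ∀ x, 0 ≤ ω x := fun x => mul_nonneg (by positivity) (profile_nonneg_member F n K x)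
  have hω1 : ∀ Y : LSite (F.P K).d, ∑ x ∈ blockIter (F.P K).L (K - n) Y, ω x = 1 := fun Y => sum_blockIter_profile_member F n K hnK Y
  set M : Site (F.P K) (K - n) → Matrix (Fin 2) (Fin 2) ℂ →ₗ[ℂ] Matrix (Fin 2) (Fin 2) ℂ := fun y =>
    ∑ x ∈ blockIter (F.P K).L (K - n) (tlift y), ((ω x : ℝ) : ℂ) •
      ((LinearMap.mulLeft ℂ ((g (tlift y) x : (Matrix (Fin 2) (Fin 2) ℂ)ˣ) : Matrix (Fin 2) (Fin 2) ℂ)).comp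
        (LinearMap.mulRight ℂ (((g (tlift y) x)⁻¹ : (Matrix (Fin 2) (Fin 2) ℂ)ˣ) : Matrix (Fin 2) (Fin 2) ℂ))) with hM
  have hMapply : ∀ (y : Site (F.P K) (K - n)) (m : Matrix (Fin 2) (Fin 2) ℂ),
      M y m = ∑ x ∈ blockIter (F.P K).L (K - n) (tlift y), ω x • conjR (g (tlift y) x) m := by
    intro y m
    rw [hM]
    simp only [LinearMap.coe_sum, Finset.sum_apply, LinearMap.smul_apply, LinearMap.coe_comp, Function.comp_apply, LinearMap.mulRight_apply,
      LinearMap.mulLeft_apply, conjR_apply, Complex.coe_smul, mul_assoc]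
  have hMfib : ∀ (u : Site (F.P K) (K - n) → Matrix (Fin 2) (Fin 2) ℂ) (y : Site (F.P K) (K - n)), QprimeCombL2 F n K (c₀ F.L) W (J₀ u) y = M y (u y) := by
    intro u y; rw [hJ₀avg u y, hMapply]
  -- the fibre defect `θ = 2·θ₃`
  set θ₃ : ℝ := (87 * 3 * (3 + 1) * (3 + 4)) * (2 * e) with hθ₃
  have hθ₃0 : 0 ≤ θ₃ := by positivity
  have hθhalf : 2 * θ₃ ≤ 1 / 2 := by rw [hθ₃]; nlinarith
  have hθlt : 2 * θ₃ < 1 := by linarith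
  have hrepF := hrep F hF n K hnK.le e W he he₃' hW
  have hσU : ∀ x, σ x ∈ U1 (Matrix (Fin 2) (Fin 2) ℂ) := fun x => oneShotAxial_mem_U1 F n K W x
  have hgU : ∀ (Y x : LSite (F.P K).d), x ∈ blockIter (F.P K).L (K - n) Y → g Y x ∈ U1 (Matrix (Fin 2) (Fin 2) ℂ) := fun Y x hx =>
    (U1 _).mul_mem (hrepF Y x hx).1 ((U1 _).inv_mem (hσU x))
  have hgnear : ∀ (Y x : LSite (F.P K).d), x ∈ blockIter (F.P K).L (K - n) Y → ‖((g Y x : (Matrix (Fin 2) (Fin 2) ℂ)ˣ) : Matrix (Fin 2) (Fin 2) ℂ) - 1‖ ≤ θ₃ := by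
    intro Y x hx
    have h := (hrepF Y x hx).2
    have hYx : (blockMap (F.P K).L)^[K - n] x = Y := Prop7QprimeCombBumpSection.iterate_blockMap_of_mem_blockIter (F.P K).L hx
    rw [hg]; simp only [hσ]; rw [hYx]; exact h
  have hθM : ∀ (y : Site (F.P K) (K - n)) (m : Matrix (Fin 2) (Fin 2) ℂ), ‖M y m - m‖ ≤ 2 * θ₃ * ‖m‖ := by
    intro y m
    rw [hMapply]
    have hid : ∑ x ∈ blockIter (F.P K).L (K - n) (tlift y), ω x • (conjR (g (tlift y) x) m - m)
        = (∑ x ∈ blockIter (F.P K).L (K - n) (tlift y), ω x • conjR (g (tlift y) x) m) - m := by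
      simp only [smul_sub, Finset.sum_sub_distrib]
      rw [← Finset.sum_smul, hω1, one_smul]
    rw [← hid]
    calc ‖∑ x ∈ blockIter (F.P K).L (K - n) (tlift y), ω x • (conjR (g (tlift y) x) m - m)‖
        ≤ ∑ x ∈ blockIter (F.P K).L (K - n) (tlift y), ω x * (2 * θ₃ * ‖m‖) := by
          refine (norm_sum_le _ _).trans (Finset.sum_le_sum fun x hx => ?_)
          rw [norm_smul, Real.norm_eq_abs, abs_of_nonneg (hω0 x)]
          refine mul_le_mul_of_nonneg_left ?_ (hω0 x)
          calc ‖conjR (g (tlift y) x) m - m‖ ≤ 2 * ‖((g (tlift y) x : (Matrix (Fin 2) (Fin 2) ℂ)ˣ) : Matrix (Fin 2) (Fin 2) ℂ) - 1‖ * ‖m‖ := norm_conjR_sub_self_le (hgU _ x hx) m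
            _ ≤ 2 * θ₃ * ‖m‖ := by gcongr; exact hgnear _ x hx
      _ = 2 * θ₃ * ‖m‖ := by rw [← Finset.sum_mul, hω1, one_mul]
  -- (iv) exactness by the fibrewise correction
  obtain ⟨N, ⟨Ny, hNfib, -, hNy⟩, hexact⟩ := exists_exact_of_fibrewise_near_id (QprimeCombL2 F n K (c₀ F.L) W) J₀ I M hMfib hθlt hθM
  have hN : ∀ (v : Site (F.P K) (K - n) → Matrix (Fin 2) (Fin 2) ℂ) (y : Site (F.P K) (K - n)), ‖N v y‖ ≤ (1 - 2 * θ₃)⁻¹ * ‖v y‖ :=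
    fibre_bound_of_fibrewise N Ny hNfib hNy
  have hκ : ((1 - 2 * θ₃)⁻¹) ^ 2 ≤ 4 := inv_one_sub_sq_le_four hθhalf
  refine ⟨I + J₀ ∘ₗ N ∘ₗ (LinearMap.id - QprimeCombL2 F n K (c₀ F.L) W ∘ₗ I), hexact, fun w => ?_, fun w => ?_⟩
  · -- (v) GRADIENT row
    have hc' : 0 ≤ c₀ F.L * ((F.L : ℝ) ^ (K - n)) ^ 3 := by positivity
    have hbe : 0 ≤ 6 * (183 + 2 * 92 * (4 * e)) ^ 2 := by positivity
    have hJ₀grad : ∀ v : Site (F.P K) (K - n) → Matrix (Fin 2) (Fin 2) ℂ,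
        ‖DL2 F n K (c₀ F.L) W (J₀ v)‖ ^ 2 ≤ 6 * (183 + 2 * 92 * (4 * e)) ^ 2 * (c₀ F.L * ((F.L : ℝ) ^ (K - n)) ^ 3 * ∑ y : Site (F.P K) (K - n), ‖v y‖ ^ 2) := by
      intro v
      have hJv : J₀ v = toL2S F K (c₀ F.L) ((toL2S F K (c₀ F.L)).symm (J₀ v)) := (LinearEquiv.apply_symm_apply _ _).symm
      rw [hJv]
      exact norm_sq_DL2_section_le hnK.le W σ hσU β (by norm_num) (by norm_num) (by positivity) (fun z => abs_profile_le_member F n K hnK z)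
        (fun z μ h => abs_profile_succ_sub_le_member F n K hnK z μ h) (fun z μ h => profile_eq_zero_member F n K z μ h)
        (fun z μ hbox => norm_oneShotAxial_bond_sub_one_le_of_regPr F n K hW z μ hbox) v _ (hJ₀pt v)
    have h := gradRow_correction_of_fibre_bound' (QprimeCombL2 F n K (c₀ F.L) W) J₀ I N (DL2 F n K (c₀ F.L) W)
      (fun u => c₀ F.L * ((F.L : ℝ) ^ (K - n)) ^ 3 * ∑ c : PBond (F.P K) (K - n), ‖conjR (T c) (u (c.src.shift c.dir)) - u c.src‖ ^ 2)
      (c := c₀ F.L * ((F.L : ℝ) ^ (K - n)) ^ 3) (κ := (1 - 2 * θ₃)⁻¹) (a₁ := CI) (a₂ := CI' * e ^ 2) (b := 6 * (183 + 2 * 92 * (4 * e)) ^ 2) (g₁ := CR) (g₂ := CR' * e ^ 2)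
      hc' hbe hN (fun u => by have h1 := hIgrad u; linarith) hJ₀grad (fun u => by have h1 := hIrep u; linarith) w
    refine h.trans ?_
    have hG0 : 0 ≤ c₀ F.L * ((F.L : ℝ) ^ (K - n)) ^ 3 * ∑ c : PBond (F.P K) (K - n), ‖conjR (T c) (w (c.src.shift c.dir)) - w c.src‖ ^ 2 := by positivity
    have hM0 : 0 ≤ c₀ F.L * ((F.L : ℝ) ^ (K - n)) ^ 3 * ∑ y : Site (F.P K) (K - n), ‖w y‖ ^ 2 := by positivity
    have hbb : 6 * (183 + 2 * 92 * (4 * e)) ^ 2 ≤ b := by rw [hbdef]; nlinarith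
    exact grad_constants_le hCR hCR' (by rw [hbdef]; positivity) hG0 hM0 hbb (by positivity) hκ
  · -- (v) SIZE row
    have hc' : 0 ≤ c₀ F.L * ((F.L : ℝ) ^ (K - n)) ^ 3 := by positivity
    have hJ₀size : ∀ v : Site (F.P K) (K - n) → Matrix (Fin 2) (Fin 2) ℂ, ‖J₀ v‖ ^ 2 ≤ b' * (c₀ F.L * ((F.L : ℝ) ^ (K - n)) ^ 3 * ∑ y : Site (F.P K) (K - n), ‖v y‖ ^ 2) := by
      intro v
      have hJv : J₀ v = toL2S F K (c₀ F.L) ((toL2S F K (c₀ F.L)).symm (J₀ v)) := (LinearEquiv.apply_symm_apply _ _).symm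
      rw [hJv, hb'def]
      exact norm_sq_toL2S_section_le hnK.le σ hσU β (fun z => abs_profile_le_member F n K hnK z) v _ (hJ₀pt v)
    have h := sizeRow_correction_of_fibre_bound' (QprimeCombL2 F n K (c₀ F.L) W) J₀ I N
      (fun u => c₀ F.L * ((F.L : ℝ) ^ (K - n)) ^ 3 * ∑ c : PBond (F.P K) (K - n), ‖conjR (T c) (u (c.src.shift c.dir)) - u c.src‖ ^ 2)
      (c := c₀ F.L * ((F.L : ℝ) ^ (K - n)) ^ 3) (κ := (1 - 2 * θ₃)⁻¹) (a₁ := 0) (a₂ := CS) (b := b') (g₁ := CR) (g₂ := CR' * e ^ 2)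
      hc' (by rw [hb'def]; positivity) hN (fun u => by have h1 := hIsize u; linarith) hJ₀size (fun u => by have h1 := hIrep u; linarith) w
    refine h.trans ?_
    have hG0 : 0 ≤ c₀ F.L * ((F.L : ℝ) ^ (K - n)) ^ 3 * ∑ c : PBond (F.P K) (K - n), ‖conjR (T c) (w (c.src.shift c.dir)) - w c.src‖ ^ 2 := by positivity
    have hM0 : 0 ≤ c₀ F.L * ((F.L : ℝ) ^ (K - n)) ^ 3 * ∑ y : Site (F.P K) (K - n), ‖w y‖ ^ 2 := by positivity
    have hGM : c₀ F.L * ((F.L : ℝ) ^ (K - n)) ^ 3 * ∑ c : PBond (F.P K) (K - n), ‖conjR (T c) (w (c.src.shift c.dir)) - w c.src‖ ^ 2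
        ≤ 12 * (c₀ F.L * ((F.L : ℝ) ^ (K - n)) ^ 3 * ∑ y : Site (F.P K) (K - n), ‖w y‖ ^ 2) := by
      have h1 := sum_norm_sq_bondDiff_le F n K T hT w
      calc _ ≤ c₀ F.L * ((F.L : ℝ) ^ (K - n)) ^ 3 * (12 * ∑ y : Site (F.P K) (K - n), ‖w y‖ ^ 2) := mul_le_mul_of_nonneg_left h1 hc'
        _ = _ := by ring
    have hb'0 : 0 ≤ b' := by rw [hb'def]; positivity
    have he1' : e ^ 2 ≤ 1 := by nlinarith
    exact size_constants_le hCR hCR' hb'0 hG0 hM0 hGM hκ he1'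

end Summit.QuantumFields.YangMills.Theorems.Prop7QprimeCombRightInverse

end
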